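import Summits.QuantumFields.YangMills.Theorems.IR.VacuumEscapeCheegerVacuum
import Literature.MathematicalPhysics.QuantumFieldTheory.Balaban1983to89.InfiniteVolumeSufficientXII
import HarnessLib

/-!
# Crux `IR` (stmt-QuantumFields-19354), line `vacuum_escape`: the strong-coupling RUNG in the vacuum-state currency PROVED —
`vacuumConductanceStrongCoupling_holds : ∀ G r, VacuumConductanceStrongCoupling G r`

Helper module for item `stmt-QuantumFields-19354` (`--supports … --as helper`).  `VacuumConductanceStrongCoupling` is the tree constant of
`Theorems/IR/VacuumEscapeCheegerVacuum.lean` (p592946; = skeleton v4's rung `SliceConductanceStrongCoupling`, body verbatim): for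
`0 ≤ β ≤ β₀` and EVERY spatial torus, every vacuum vector's one-step coupling has setwise conductance `c`, with ONE `c > 0`.

**Proof** (the variational direction of Cheeger + the tree's volume-uniform strong-coupling transfer gap): with
`β₀ = strongCouplingRadius r.ρ` and `c = 1 − e^{−1/4}`.  The tree's Kotecký–Preiss rung
`Balaban1983to89.Missing.transferGap_of_strongCoupling` gives, on every spatial torus, an eigenbasis of Lüscher's transfer matrix with
`λᵢ ≤ e^{−1/4} λ_{i₀}` for `i ≠ i₀`.  A vacuum vector `Ω` equals the pointwise ground state `h` a.e. (simplicity of the top eigenvalue,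
positivity), so `π(A) = ∫_A h² =: P` and `Q(A × Aᶜ) = P − λ₀⁻¹⟨1_A h, 𝕋(1_A h)⟩`; expanding `1_A h` in the eigenbasis,
`⟨1_A h, 𝕋(1_A h)⟩ = Σ λᵢ ⟪bᵢ, 1_A h⟫² ≤ λ₀ P² + e^{−1/4} λ₀ (P − P²)` (`⟪b_{i₀}, 1_A h⟫² = P²`, Parseval), i.e.
`Q(A × Aᶜ) ≥ (1 − e^{−1/4}) P (1 − P) = c π(A) π(Aᶜ)`.

HONEST FRAMING: a FORMAT rung inside the known (strong-coupling) regime of crux `IR`; it says nothing at weak coupling and is not a BC5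
witness of weakness; the YM mass gap (Clay) is NOT proved; `R4` closes only the conditional rung `BalabanLadder.UV`.
Refs: K. Osterwalder, E. Seiler, Ann. Phys. 110 (1978) 440 §3; G. F. Lawler, A. D. Sokal, Trans. AMS 309 (1988) 557 ((2.18), variational
direction); tree files named above.
-/

set_option autoImplicit false

noncomputable section

open MeasureTheory Filter Set Function
open scoped RealInnerProductSpace ENNReal Topology
open Literature.Analysis.OperatorTheory Literature.MathematicalPhysics.QuantumFieldTheory Literature.Probability.MarkovChains
open Literature.MathematicalPhysics.QuantumFieldTheory.Balaban1983to89.Missing (strongCouplingRadius strongCouplingRadius_pos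
  transferGap_of_strongCoupling)
open Summit.QuantumFields.YangMills.Cruxes.IR.VacuumEscape.GroundState

namespace Summit.QuantumFields.YangMills.Cruxes.IR.VacuumEscape

section Abstract

variable {X : Type*} [MeasurableSpace X] {μ : Measure X} [IsProbabilityMeasure μ] {K : X → X → ℝ}
  {A : Lp ℝ 2 μ →L[ℝ] Lp ℝ 2 μ} {ι : Type*} {b : HilbertBasis ι ℝ (Lp ℝ 2 μ)} {lam : ι → ℝ}

/-- **Variational bound on the vacuum two-set overlap** (the direction `(2.18)` of Lawler–Sokal): if `A` has kernel `K`, is self-adjoint with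
eigenbasis `A bᵢ = λᵢ bᵢ`, `b_{i₀} = ε h` a.e. (`ε² = 1`, `h` bounded measurable) and `λᵢ ≤ λ₁` for `i ≠ i₀`, then for every measurable `S`,
`∫_S ∫_S h K h ≤ λ₁ P + (λ_{i₀} − λ₁) P²` with `P = ∫_S h²` (expand `1_S h` in the eigenbasis: `⟪b_{i₀}, 1_S h⟫² = P²`, `‖1_S h‖² = P`). -/
theorem setIntegral_kernel_le_of_gap (hA : ∀ φ : Lp ℝ 2 μ, (A φ : X → ℝ) =ᵐ[μ] fun x => ∫ y, K x y * φ y ∂μ)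
    (hsa : IsSelfAdjoint A) (hb : ∀ i, A (b i) = lam i • b i) {i₀ : ι} {lam1 : ℝ} (hgap : ∀ i, i ≠ i₀ → lam i ≤ lam1)
    {h : X → ℝ} (hhm : Measurable h) {B : ℝ} (hhB : ∀ x, ‖h x‖ ≤ B) {ε : ℝ} (hε2 : ε ^ 2 = 1)
    (hbε : (b i₀ : X → ℝ) =ᵐ[μ] fun x => ε * h x) {S : Set X} (hS : MeasurableSet S) :
    ∫ x in S, ∫ y in S, h x * K x y * h y ∂μ ∂μ ≤
      lam1 * (∫ x in S, h x ^ 2 ∂μ) + (lam i₀ - lam1) * (∫ x in S, h x ^ 2 ∂μ) ^ 2 := by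
  have hμu : μ (univ : Set X) ≠ 0 := by rw [measure_univ]; exact one_ne_zero
  obtain ⟨x₀, -⟩ : (univ : Set X).Nonempty := nonempty_of_measure_ne_zero hμu
  have hB0 : 0 ≤ B := (norm_nonneg _).trans (hhB x₀)
  -- the trial vector `g = 1_S h`
  obtain ⟨f, hf⟩ : ∃ f : X → ℝ, f = S.indicator (fun _ => (1 : ℝ)) := ⟨_, rfl⟩
  have hfm : Measurable f := by rw [hf]; exact measurable_const.indicator hS
  have hfx : ∀ x, (x ∈ S → f x = 1) ∧ (x ∉ S → f x = 0) := fun x =>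
    ⟨fun hx => by rw [hf, Set.indicator_of_mem hx], fun hx => by rw [hf, Set.indicator_of_notMem hx]⟩
  obtain ⟨g, hgdef⟩ : ∃ g : X → ℝ, g = fun x => f x * h x := ⟨_, rfl⟩
  have hgx : ∀ x, g x = f x * h x := fun x => by rw [hgdef]
  have hgm : Measurable g := by rw [hgdef]; exact hfm.mul hhm
  have hgb : ∀ x, ‖g x‖ ≤ B := fun x => by
    rw [hgx]
    by_cases hx : x ∈ S
    · rw [(hfx x).1 hx, one_mul]; exact hhB x
    · rw [(hfx x).2 hx, zero_mul, norm_zero]; exact hB0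
  obtain ⟨gL, hgcoe⟩ : ∃ gL : Lp ℝ 2 μ, (gL : X → ℝ) =ᵐ[μ] g :=
    ⟨(memLp_two_of_bound (μ := μ) hgm hgb).toLp g, MemLp.coeFn_toLp _⟩
  have hgg : ∀ x, g x * g x = S.indicator (fun x => h x ^ 2) x := fun x => by
    rw [hgx]
    by_cases hx : x ∈ S
    · rw [(hfx x).1 hx, Set.indicator_of_mem hx]; ring
    · rw [(hfx x).2 hx, Set.indicator_of_notMem hx]; ring
  have hnormg : ‖gL‖ ^ 2 = ∫ x in S, h x ^ 2 ∂μ := by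
    rw [← real_inner_self_eq_norm_sq, inner_eq_integral]
    have e1 : ∫ x, gL x * gL x ∂μ = ∫ x, g x * g x ∂μ :=
      integral_congr_ae (by filter_upwards [hgcoe] with x hx; rw [hx])
    rw [e1]
    simp_rw [hgg]
    rw [integral_indicator hS]
  have hinner0 : ⟪b i₀, gL⟫ ^ 2 = (∫ x in S, h x ^ 2 ∂μ) ^ 2 := by
    have e0 : ⟪b i₀, gL⟫ = ⟪gL, b i₀⟫ := real_inner_comm gL (b i₀)
    rw [e0, inner_eq_integral]
    have e1 : ∫ x, gL x * (b i₀) x ∂μ = ∫ x, g x * (ε * h x) ∂μ :=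
      integral_congr_ae (by filter_upwards [hgcoe, hbε] with x hx hx'; rw [hx, hx'])
    have e3 : ∀ x, g x * (ε * h x) = ε * S.indicator (fun x => h x ^ 2) x := fun x => by
      rw [hgx]
      by_cases hx : x ∈ S
      · rw [(hfx x).1 hx, Set.indicator_of_mem hx]; ring
      · rw [(hfx x).2 hx, Set.indicator_of_notMem hx]; ring
    have e2 : ∫ x, g x * (ε * h x) ∂μ = ε * (∫ x in S, h x ^ 2 ∂μ) := by
      rw [integral_congr_ae (Eventually.of_forall e3), integral_const_mul, integral_indicator hS]
    rw [e1, e2, mul_pow, hε2, one_mul]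
  -- Parseval
  have hPar1 : HasSum (fun i => lam i * ⟪b i, gL⟫ ^ 2) ⟪gL, A gL⟫ := by
    have h1 := b.hasSum_inner_mul_inner gL (A gL)
    refine h1.congr_fun fun i => ?_
    have h2 : ⟪b i, A gL⟫ = lam i * ⟪b i, gL⟫ := by
      rw [← hsa.isSymmetric.apply_clm, hb i, real_inner_smul_left]
    rw [h2, real_inner_comm gL (b i)]; ring
  have hPar2 : HasSum (fun i => ⟪b i, gL⟫ ^ 2) (‖gL‖ ^ 2) := by
    have h1 := b.hasSum_inner_mul_inner gL gL
    rw [real_inner_self_eq_norm_sq] at h1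
    refine h1.congr_fun fun i => ?_
    rw [real_inner_comm gL (b i)]; ring
  have hbound : ⟪gL, A gL⟫ ≤ lam1 * ‖gL‖ ^ 2 + (lam i₀ - lam1) * ⟪b i₀, gL⟫ ^ 2 := by
    classical
    have hG : HasSum (fun i => lam1 * ⟪b i, gL⟫ ^ 2 + (if i = i₀ then (lam i₀ - lam1) * ⟪b i₀, gL⟫ ^ 2 else 0))
        (lam1 * ‖gL‖ ^ 2 + (lam i₀ - lam1) * ⟪b i₀, gL⟫ ^ 2) :=
      (hPar2.mul_left lam1).add (hasSum_ite_eq i₀ _)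
    refine hasSum_le (fun i => ?_) hPar1 hG
    split_ifs with hi
    · subst hi
      exact le_of_eq (by ring)
    · have h1 : lam i * ⟪b i, gL⟫ ^ 2 ≤ lam1 * ⟪b i, gL⟫ ^ 2 := mul_le_mul_of_nonneg_right (hgap i hi) (sq_nonneg _)
      simpa only [add_zero] using h1
  rw [hnormg, hinner0] at hbound
  -- `⟪gL, A gL⟫ = ∫_S ∫_S h K h`
  have hinnerA : ⟪gL, A gL⟫ = ∫ x in S, ∫ y in S, h x * K x y * h y ∂μ ∂μ := by
    rw [inner_kernelOp_eq_integral hA gL gL]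
    have e1 : ∀ x, ∫ y, K x y * gL y ∂μ = ∫ y, K x y * g y ∂μ := fun x =>
      integral_congr_ae (by filter_upwards [hgcoe] with y hy; rw [hy])
    simp_rw [e1]
    have e2 : ∫ x, gL x * ∫ y, K x y * g y ∂μ ∂μ = ∫ x, g x * ∫ y, K x y * g y ∂μ ∂μ :=
      integral_congr_ae (by filter_upwards [hgcoe] with x hx; rw [hx])
    rw [e2, ← integral_indicator hS]
    refine integral_congr_ae (Eventually.of_forall fun x => ?_)
    have hin : ∫ y, K x y * g y ∂μ = ∫ y in S, K x y * h y ∂μ := by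
      rw [← integral_indicator hS]
      refine integral_congr_ae (Eventually.of_forall fun y => ?_)
      beta_reduce
      rw [hgx]
      by_cases hy : y ∈ S
      · rw [(hfx y).1 hy, Set.indicator_of_mem hy, one_mul]
      · rw [(hfx y).2 hy, Set.indicator_of_notMem hy, zero_mul, mul_zero]
    beta_reduce
    rw [hin, hgx]
    by_cases hx : x ∈ S
    · rw [(hfx x).1 hx, Set.indicator_of_mem hx, one_mul, ← integral_const_mul]
      refine integral_congr_ae (Eventually.of_forall fun y => ?_); ring
    · rw [(hfx x).2 hx, Set.indicator_of_notMem hx, zero_mul, zero_mul]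
  rw [← hinnerA]
  exact hbound

end Abstract

section PerTorus

variable {G : Type} [Group G] [TopologicalSpace G] [IsTopologicalGroup G] [CompactSpace G] [MeasurableSpace G] [BorelSpace G]
  [SecondCountableTopology G] {n : ℕ} {ρ : G →* Matrix (Fin n) (Fin n) ℂ}

omit [IsTopologicalGroup G] [CompactSpace G] [MeasurableSpace G] [BorelSpace G] [SecondCountableTopology G] in
/-- `σ² = 1 ⇒ σ = ±1` (kept out of the large proof context). -/
theorem sq_eq_one_cases {σ : ℝ} (h : σ ^ 2 = 1) : σ = 1 ∨ σ = -1 := by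
  have : (σ - 1) * (σ + 1) = 0 := by nlinarith [h]
  rcases mul_eq_zero.1 this with h1 | h1
  · left; linarith
  · right; linarith

omit [IsTopologicalGroup G] [CompactSpace G] [MeasurableSpace G] [BorelSpace G] [SecondCountableTopology G] in
/-- The closing arithmetic of the variational bound (kept out of the large proof context):
`X ≤ e P + (1 − e) P²` gives `(1 − e) P (1 − P) ≤ P − X`. -/
theorem conductance_arith {e P X : ℝ} (h : X ≤ e * P + (1 - e) * P ^ 2) : (1 - e) * P * (1 - P) ≤ P - X := by
  nlinarith [h]

omit [IsTopologicalGroup G] [CompactSpace G] [MeasurableSpace G] [BorelSpace G] [SecondCountableTopology G] in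
/-- Normalising the variational bound by `λ₀` (kept out of the large proof context). -/
theorem inv_mul_gap_arith {l e P I : ℝ} (hl : 0 < l) (h : I ≤ e * l * P + (l - e * l) * P ^ 2) :
    l⁻¹ * I ≤ e * P + (1 - e) * P ^ 2 := by
  have h1 := mul_le_mul_of_nonneg_left h (inv_nonneg.2 hl.le)
  refine h1.trans (le_of_eq ?_)
  field_simp
set_option maxHeartbeats 400000 in
/-- **The rung on one torus.**  For continuous unitary `ρ` and `0 ≤ β ≤ strongCouplingRadius ρ`, every vacuum vector `Ω` of the spatial
torus `(2S+1)³` has one-step conductance `1 − e^{−1/4}`: `(1 − e^{−1/4}) π(A) π(Aᶜ) ≤ Q(A × Aᶜ)` for every measurable `A`. -/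
theorem hasCouplingConductance_vacuum_of_strongCoupling (hρ : Continuous ρ) (hρu : ∀ g, ρ g ∈ Matrix.unitaryGroup (Fin n) ℂ)
    {β : ℝ} (hβ0 : 0 ≤ β) (hβ : β ≤ strongCouplingRadius ρ) (S : ℕ) :
    ∀ Ω : Lp ℝ 2 (Measure.pi fun _ : Edge 3 (2 * S + 1) => haarProbability G), IsVacuum ρ β (2 * S + 1) Ω →
      HasCouplingConductance (vacuumMeasure Ω) (vacuumCoupling ρ β (2 * S + 1) Ω) (1 - Real.exp (-(1 / 4))) := by
  classical
  set μ : Measure (GaugeConfig 3 (2 * S + 1) G) := Measure.pi fun _ : Edge 3 (2 * S + 1) => haarProbability G with hμ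
  set K : GaugeConfig 3 (2 * S + 1) G → GaugeConfig 3 (2 * S + 1) G → ℝ := wilsonSliceKernel ρ β with hKdef
  set A := wilsonTorusTransferMatrix ρ β (2 * S + 1) with hAdef
  -- kernel facts
  have hK : StronglyMeasurable (uncurry K) := stronglyMeasurable_uncurry_wilsonSliceKernel ρ hρ β
  obtain ⟨C, hC⟩ := exists_norm_wilsonSliceKernel_le (L := (2 * S + 1)) ρ hρ β
  have hsymm : ∀ x y, K x y = K y x := wilsonSliceKernel_symm ρ hρu β
  have hpos : ∀ x y, 0 < K x y := wilsonSliceKernel_pos ρ hρ β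
  obtain ⟨κ₀, hκ₀, hKmin⟩ : ∃ κ₀ : ℝ, 0 < κ₀ ∧ ∀ U U' : GaugeConfig 3 (2 * S + 1) G, κ₀ ≤ K U U' := by
    have hcont := continuous_uncurry_wilsonSliceKernel (L := (2 * S + 1)) ρ hρ β
    obtain ⟨p, -, hp⟩ := isCompact_univ.exists_isMinOn univ_nonempty hcont.continuousOn
    exact ⟨K p.1 p.2, hpos p.1 p.2, fun U U' => (isMinOn_iff.mp hp) (U, U') (mem_univ _)⟩
  have hKnn : ∀ x y, 0 ≤ K x y := fun x y => (hpos x y).le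
  have hAker : ∀ φ : Lp ℝ 2 μ, (A φ : GaugeConfig 3 (2 * S + 1) G → ℝ) =ᵐ[μ] fun U => ∫ U', K U U' * φ U' ∂μ :=
    wilsonTorusTransferMatrix_ae_eq β (2 * S + 1) hρ
  have hsa : IsSelfAdjoint A := isSelfAdjoint_wilsonTorusTransferMatrix (2 * S + 1) hρ hρu β
  have hcpt : IsCompactOperator A := isCompactOperator_wilsonTorusTransferMatrix β (2 * S + 1) hρ
  have himp : IsPositivityImproving A := isPositivityImproving_wilsonTorusTransferMatrix β (2 * S + 1) hρ
  have hA0 : A ≠ 0 := wilsonTorusTransferMatrix_ne_zero β (2 * S + 1) hρ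
  -- the strong-coupling eigenbasis with its volume-uniform gap
  obtain ⟨s, hs, b, lam, i₀, hb, hle, hL0, hrad, hgap⟩ := transferGap_of_strongCoupling (L := (2 * S + 1)) ρ hρ hρu hβ0 hβ
  haveI : Countable s := hs
  have hlam0 : ∀ i, 0 ≤ lam i := fun i => (hle i).1
  -- `lam i₀ = ‖A‖` (both are the growth rate `transferSpectralRadius`)
  have hi₀ : lam i₀ = ‖A‖ := by
    obtain ⟨s', -, b', lam', i₀', -, -, -, hi₀', -, hrad', -⟩ := exists_spectralData_wilsonTorusTransferMatrix (2 * S + 1) hρ hρu hβ0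
    rw [← hrad, hrad', hi₀']
  -- ground-state data for this basis
  obtain ⟨h, B, h₀, θ, hhm, hhB, hh₀, hlow, heig, hnorm, ⟨ε, hε2, hbε⟩, horth, -, -, -⟩ :=
    exists_groundState_data (μ := μ) hK hC hsymm hpos hκ₀ hKmin hAker hsa hcpt himp hA0 hb hlam0 hi₀
  set lam₀ : ℝ := lam i₀ with hlam₀def
  have hhpos : ∀ x, 0 < h x := fun x => hh₀.trans_le (hlow x)
  -- the given vacuum `Ω` is `h` a.e.
  obtain ⟨φ, hφ1, hφpos, hAφ, hsimple, -⟩ := himp.exists_spectralGap hsa hcpt hA0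
  intro Ω hΩ
  obtain ⟨hΩ1, hAΩ, hΩpos⟩ := hΩ
  have hμ0 : μ ≠ 0 := IsProbabilityMeasure.ne_zero μ
  have hΩφ : Ω = ⟪φ, Ω⟫ • φ := hsimple Ω hAΩ
  have hbφ : b i₀ = ⟪φ, b i₀⟫ • φ := hsimple (b i₀) (by rw [hb i₀, ← hlam₀def, hi₀])
  set a₁ : ℝ := ⟪φ, Ω⟫ with ha₁
  set a₂ : ℝ := ⟪φ, b i₀⟫ with ha₂
  have ha₁sq : a₁ ^ 2 = 1 := by
    have h1 : ‖Ω‖ = |a₁| * ‖φ‖ := by conv_lhs => rw [hΩφ]; rw [norm_smul, Real.norm_eq_abs]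
    rw [hΩ1, hφ1, mul_one] at h1; rw [← sq_abs, ← h1, one_pow]
  have ha₂sq : a₂ ^ 2 = 1 := by
    have h1 : ‖b i₀‖ = |a₂| * ‖φ‖ := by conv_lhs => rw [hbφ]; rw [norm_smul, Real.norm_eq_abs]
    rw [b.orthonormal.norm_eq_one i₀, hφ1, mul_one] at h1; rw [← sq_abs, ← h1, one_pow]
  -- `Ω = (a₁ a₂) • b i₀`
  have hΩb : Ω = (a₁ * a₂) • b i₀ := by
    rw [hbφ, smul_smul, mul_assoc, ← sq, ha₂sq, mul_one, ← hΩφ]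
  set σ : ℝ := a₁ * a₂ * ε with hσ
  have hσ2 : σ ^ 2 = 1 := by rw [hσ, mul_pow, mul_pow, ha₁sq, ha₂sq, hε2]; ring
  have hΩσ : (Ω : GaugeConfig 3 (2 * S + 1) G → ℝ) =ᵐ[μ] fun x => σ * h x := by
    rw [hΩb]
    filter_upwards [Lp.coeFn_smul (a₁ * a₂) (b i₀), hbε] with x hx hx'
    rw [hx, Pi.smul_apply, smul_eq_mul, hx', hσ]; ring
  have hσ1 : σ = 1 := by
    rcases sq_eq_one_cases hσ2 with h1 | h1
    · exact h1
    · exfalso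
      haveI : (ae μ).NeBot := ae_neBot.2 hμ0
      obtain ⟨x, hx1, hx2⟩ := ((show ∀ᵐ x ∂μ, 0 < (Ω : GaugeConfig 3 (2 * S + 1) G → ℝ) x from hΩpos).and hΩσ).exists
      beta_reduce at hx1 hx2
      rw [hx2, h1, neg_one_mul] at hx1
      exact absurd hx1 (not_lt.2 (neg_nonpos.2 (hhpos x).le))
  have hcoe : (Ω : GaugeConfig 3 (2 * S + 1) G → ℝ) =ᵐ[μ] h := by
    filter_upwards [hΩσ] with x hx; rw [hx, hσ1, one_mul]
  -- the vacuum measure / coupling are the ground-state measures of `h`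
  have hμu : μ (univ : Set (GaugeConfig 3 (2 * S + 1) G)) ≠ 0 := by rw [measure_univ]; exact one_ne_zero
  obtain ⟨x₀, -⟩ : (univ : Set (GaugeConfig 3 (2 * S + 1) G)).Nonempty := nonempty_of_measure_ne_zero hμu
  have hB0 : 0 ≤ B := (norm_nonneg _).trans (hhB x₀)
  have hC0 : 0 ≤ C := (norm_nonneg _).trans (hC x₀ x₀)
  set D : GaugeConfig 3 (2 * S + 1) G × GaugeConfig 3 (2 * S + 1) G → ℝ := fun p => lam₀⁻¹ * (h p.1 * K p.1 p.2 * h p.2) with hD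
  have hKm : Measurable (uncurry K) := hK.measurable
  have hDm : Measurable D := measurable_const.mul (((hhm.comp measurable_fst).mul hKm).mul (hhm.comp measurable_snd))
  have hD0 : ∀ p, 0 ≤ D p := fun p =>
    mul_nonneg (inv_nonneg.2 hL0.le) (mul_nonneg (mul_nonneg (hhpos _).le (hKnn _ _)) (hhpos _).le)
  have hDb : ∀ p, ‖D p‖ ≤ lam₀⁻¹ * (B * C * B) := by
    intro p
    rw [hD]
    refine norm_mul_le_of_le (by rw [Real.norm_eq_abs, abs_of_nonneg (inv_nonneg.2 hL0.le)]) ?_ (inv_nonneg.2 hL0.le)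
    exact norm_mul_le_of_le (norm_mul_le_of_le (hhB _) (hC _ _) hB0) (hhB _) (mul_nonneg hB0 hC0)
  have hDi : Integrable D (μ.prod μ) := integrable_of_bdd hDm hDb
  have hπeq : vacuumMeasure Ω = μ.withDensity (fun x => ENNReal.ofReal (h x ^ 2)) := by
    unfold vacuumMeasure
    refine withDensity_congr_ae ?_
    filter_upwards [hcoe] with x hx
    rw [hx]
  have hρeq : vacuumCoupling ρ β (2 * S + 1) Ω = (μ.prod μ).withDensity (fun p => ENNReal.ofReal (D p)) := by
    unfold vacuumCoupling
    refine withDensity_congr_ae ?_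
    have h1 : (fun p : GaugeConfig 3 (2 * S + 1) G × GaugeConfig 3 (2 * S + 1) G => (Ω : GaugeConfig 3 (2 * S + 1) G → ℝ) p.1) =ᵐ[μ.prod μ] fun p => h p.1 :=
      Measure.quasiMeasurePreserving_fst.ae_eq_comp hcoe
    have h2 : (fun p : GaugeConfig 3 (2 * S + 1) G × GaugeConfig 3 (2 * S + 1) G => (Ω : GaugeConfig 3 (2 * S + 1) G → ℝ) p.2) =ᵐ[μ.prod μ] fun p => h p.2 :=
      Measure.quasiMeasurePreserving_snd.ae_eq_comp hcoe
    filter_upwards [h1, h2] with p hp1 hp2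
    rw [hp1, hp2, ← hi₀, hD]
    simp only
    congr 1
    rw [div_eq_inv_mul]
  -- set functions
  have hh2m : Measurable fun x => h x ^ 2 := hhm.pow_const 2
  have hh2b : ∀ x, ‖h x ^ 2‖ ≤ B ^ 2 := fun x => by
    rw [Real.norm_eq_abs, abs_of_nonneg (sq_nonneg _)]
    have := hhB x
    rw [Real.norm_eq_abs] at this
    calc h x ^ 2 = |h x| ^ 2 := (sq_abs _).symm
      _ ≤ B ^ 2 := pow_le_pow_left₀ (abs_nonneg _) this 2
  have hh2i : Integrable (fun x => h x ^ 2) μ := integrable_of_bdd hh2m hh2b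
  have hπA : ∀ Aset : Set (GaugeConfig 3 (2 * S + 1) G), MeasurableSet Aset → (vacuumMeasure Ω).real Aset = ∫ x in Aset, h x ^ 2 ∂μ := by
    intro Aset hA
    rw [measureReal_def, hπeq, withDensity_apply _ hA,
      ← ofReal_integral_eq_lintegral_ofReal hh2i.integrableOn (Eventually.of_forall fun x => sq_nonneg (h x)),
      ENNReal.toReal_ofReal (setIntegral_nonneg hA fun x _ => sq_nonneg _)]
  haveI hπprob : IsProbabilityMeasure (vacuumMeasure Ω) := by
    refine ⟨?_⟩
    rw [hπeq, withDensity_apply _ MeasurableSet.univ, Measure.restrict_univ,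
      ← ofReal_integral_eq_lintegral_ofReal hh2i (Eventually.of_forall fun x => sq_nonneg (h x)), hnorm, ENNReal.ofReal_one]
  have hρAE : ∀ Aset E : Set (GaugeConfig 3 (2 * S + 1) G), MeasurableSet Aset → MeasurableSet E →
      (vacuumCoupling ρ β (2 * S + 1) Ω).real (Aset ×ˢ E) = ∫ x in Aset, ∫ y in E, D (x, y) ∂μ ∂μ := by
    intro Aset E hA hE
    rw [measureReal_def, hρeq, withDensity_apply _ (hA.prod hE),
      ← ofReal_integral_eq_lintegral_ofReal hDi.integrableOn (Eventually.of_forall fun p => hD0 p),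
      ENNReal.toReal_ofReal (setIntegral_nonneg (hA.prod hE) fun p _ => hD0 p), setIntegral_prod D hDi.integrableOn]
  have hrow : ∀ x, ∫ y, D (x, y) ∂μ = h x ^ 2 := by
    intro x
    simp only [hD]
    rw [integral_const_mul]
    have : ∫ y, h x * K x y * h y ∂μ = h x * ∫ y, K x y * h y ∂μ := by
      rw [← integral_const_mul]
      refine integral_congr_ae (Eventually.of_forall fun y => ?_); ring
    rw [this, heig x]
    field_simp
  have hDx : ∀ x, Integrable (fun y => D (x, y)) μ := fun x =>
    integrable_of_bdd (hDm.comp measurable_prodMk_left) fun y => hDb (x, y)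
  -- the conductance bound, set by set
  intro Aset hA
  -- the variational bound `∫_A∫_A hKh ≤ e^{-1/4} λ₀ P + (λ₀ − e^{-1/4} λ₀) P²`
  have hvar := setIntegral_kernel_le_of_gap (μ := μ) hAker hsa hb (i₀ := i₀) (lam1 := Real.exp (-(1 / 4)) * lam₀)
    hgap hhm hhB hε2 hbε hA
  -- the set functions of the vacuum coupling
  have hPc : (vacuumMeasure Ω).real Asetᶜ = 1 - (∫ x in Aset, h x ^ 2 ∂μ) := by rw [probReal_compl_eq_one_sub hA, hπA Aset hA]
  have hR : (vacuumCoupling ρ β (2 * S + 1) Ω).real (Aset ×ˢ Asetᶜ) = (∫ x in Aset, h x ^ 2 ∂μ) - lam₀⁻¹ * ∫ x in Aset, ∫ y in Aset, h x * K x y * h y ∂μ ∂μ := by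
    rw [hρAE Aset Asetᶜ hA hA.compl]
    have hin : ∀ x, ∫ y in Asetᶜ, D (x, y) ∂μ = h x ^ 2 - ∫ y in Aset, D (x, y) ∂μ := by
      intro x
      rw [setIntegral_compl hA (hDx x), hrow x]
    simp_rw [hin]
    have hDunc : StronglyMeasurable (uncurry fun x y => D (x, y)) :=
      (hDm.comp (measurable_fst.prodMk measurable_snd)).stronglyMeasurable
    rw [integral_sub hh2i.integrableOn ?_]
    · congr 1
      rw [← integral_const_mul]
      refine setIntegral_congr_fun hA fun x _ => ?_
      rw [← integral_const_mul]
    · refine (integrable_of_bdd (B := lam₀⁻¹ * (B * C * B) * μ.real univ) ?_ fun x => ?_).integrableOn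
      · exact (hDunc.integral_prod_right' (ν := μ.restrict Aset)).measurable
      · rw [Real.norm_eq_abs]
        calc |∫ y in Aset, D (x, y) ∂μ| ≤ ∫ y in Aset, |D (x, y)| ∂μ := abs_integral_le_integral_abs
          _ ≤ ∫ y in Aset, lam₀⁻¹ * (B * C * B) ∂μ := by
              refine setIntegral_mono_on ?_ ?_ hA fun y _ => ?_
              · exact (hDx x).abs.integrableOn
              · exact (integrable_const _).integrableOn
              · have := hDb (x, y); rwa [Real.norm_eq_abs] at this
          _ = lam₀⁻¹ * (B * C * B) * μ.real Aset := by rw [setIntegral_const, smul_eq_mul, mul_comm]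
          _ ≤ lam₀⁻¹ * (B * C * B) * μ.real univ :=
              mul_le_mul_of_nonneg_left (measureReal_mono (subset_univ _) (measure_ne_top _ _))
                (mul_nonneg (inv_nonneg.2 hL0.le) (mul_nonneg (mul_nonneg hB0 hC0) hB0))
  rw [hπA Aset hA, hPc, hR]
  -- arithmetic: `(1 − e^{-1/4}) P (1 − P) ≤ P − λ₀⁻¹ ∫_A∫_A hKh`
  have hkey : lam₀⁻¹ * ∫ x in Aset, ∫ y in Aset, h x * K x y * h y ∂μ ∂μ ≤
      Real.exp (-(1 / 4)) * (∫ x in Aset, h x ^ 2 ∂μ) + (1 - Real.exp (-(1 / 4))) * (∫ x in Aset, h x ^ 2 ∂μ) ^ 2 :=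
    inv_mul_gap_arith hL0 hvar
  exact conductance_arith hkey

end PerTorus

/-- **The strong-coupling rung PROVED** (vacuum-state currency of skeleton v4): for every compact `G` with a lattice representation `r`
there are `c = 1 − e^{−1/4} > 0` and `β₀ = strongCouplingRadius r.ρ > 0` such that for `0 ≤ β ≤ β₀`, every spatial torus and every vacuum vector,
the one-step vacuum coupling has setwise conductance `c`. -/
theorem vacuumConductanceStrongCoupling_holds :
    ∀ (G : Type) [Group G] [TopologicalSpace G] [IsTopologicalGroup G] [CompactSpace G]
      [MeasurableSpace G] [BorelSpace G] (r : LatticeRep G), VacuumConductanceStrongCoupling G r := by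
  intro G _ _ _ _ _ _ r
  haveI : SecondCountableTopology G :=
    (r.continuous.isClosedEmbedding r.injective).isEmbedding.secondCountableTopology
  refine ⟨1 - Real.exp (-(1 / 4)), strongCouplingRadius r.ρ, ?_, strongCouplingRadius_pos r.ρ, fun β hβ0 hβ S Ω hΩ => ?_⟩
  · have : Real.exp (-(1 / 4 : ℝ)) < 1 := Real.exp_lt_one_iff.2 (by norm_num)
    linarith
  · exact hasCouplingConductance_vacuum_of_strongCoupling r.continuous r.mem_unitary hβ0 hβ S Ω hΩ

end Summit.QuantumFields.YangMills.Cruxes.IR.VacuumEscape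

end
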